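import Literature.ModelTheory.ExponentialFields.PartialDerivWords
import Mathlib.Analysis.Calculus.Deriv.Prod
import Mathlib.Analysis.Calculus.ContDiff.RCLike
import HarnessLib

/-!
# The key estimate in the change of the last variable (Bhardwaj–van den Dries 2022, Lemma 6.2, steps (i)–(v))

Topic `Literature/ModelTheory/ExponentialFields`; proof file in the cone of the named fact
`PilaWilkie2006_thm_1_8`.  The real-analysis core of the proof of Bhardwaj–van den Dries
2022, Lemma 6.2: from (i) continuity of `∂f/∂x_{m+1}`, (ii) convergence `F_s'(t₁) → ψ'(t₁)`,
(iii) the ball about `(a₀, F_s(t₁))` inside `U`, the maximizing point `b = (a_s(t), t)` and the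
derivative bounds (iv), (v) of the reparametrized family, the chain of inequalities giving
`|ψ'(t₁) ∂f/∂x_{m+1}(a₀, ψ(t₁))| ≤ 3 + m B₁`.

* `deriv_comp_curve` — `(g ∘ γ)'(t) = Σ_i γ_i'(t) ∂_i g(γ(t))`;
* `key_estimate` — the estimate, with all o-minimal/definable input abstracted into
  hypotheses.

Nothing here is a named fact; no definitions.

## References

* N. Bhardwaj, L. van den Dries, *On the Pila–Wilkie theorem*, Expo. Math. 40 (2022), §6,
  proof of Lemma 6.2. [BhardwajVanDenDries2022]
-/

noncomputable section

open Set Filter Topology Function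

namespace Literature.ModelTheory.ExponentialFields

/-! ### The key estimate of Bhardwaj–van den Dries 2022, Lemma 6.2 -/

section KeyEstimate

variable {m n : ℕ}

/-- Chain rule along a curve: `(g ∘ γ)'(t) = Σ_i γ_i'(t) · ∂_i g(γ(t))`. [folklore] -/
theorem deriv_comp_curve {N : ℕ} {g : (Fin N → ℝ) → ℝ} {γ : ℝ → Fin N → ℝ} {t : ℝ}
    (hg : DifferentiableAt ℝ g (γ t)) (hγ : ∀ i, DifferentiableAt ℝ (fun s => γ s i) t) :
    deriv (fun s => g (γ s)) t = ∑ i, deriv (fun s => γ s i) t * pderiv i g (γ t) := by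
  have hγ' : DifferentiableAt ℝ γ t := differentiableAt_pi.mpr hγ
  have h := hg.hasFDerivAt.comp_hasDerivAt t hγ'.hasDerivAt
  rw [show (fun s => g (γ s)) = g ∘ γ from rfl, h.deriv]
  -- decompose `deriv γ t` in the standard basis
  have hdec : deriv γ t = ∑ i, deriv (fun s => γ s i) t • (Pi.single i (1 : ℝ) : Fin N → ℝ) := by
    have h1 : deriv γ t = fun i => deriv (fun s => γ s i) t := by
      ext i; exact congrFun (deriv_pi fun i => hγ i) i
    rw [h1]
    ext i
    simp [Finset.sum_apply, Pi.single_apply]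
  rw [hdec, map_sum]
  refine Finset.sum_congr rfl fun i _ => ?_
  rw [map_smul, smul_eq_mul]
  rfl

/-- **The key estimate** in the proof of Bhardwaj–van den Dries 2022, Lemma 6.2 (steps
(i)–(v) and the final chain of inequalities *"`|ψ'(t₁) ∂f/∂x_{m+1}(a₀, ψ(t₁))| ≤ … ≤ 3 + mB₁`"*),
isolated as a statement of real analysis: `g_c` are `C¹` on the open `U` with
`|∂g_c/∂x_i| ≤ B₁` (`i ≤ m`); `ψ(t₁)` and `ψ'(t₁)` are limits of `F_s(t₁)`, `F_s'(t₁)` as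
`s → 0⁺`, `|F_s'(t₁)| ≤ 1`; and for all small `s` with the ball of radius `s` about
`(a₀, F_s(t₁))` inside `U` there is a point `b ∈ U` over `F_s(t₁)` dominating the last partials
at `(a₀, F_s(t₁))` through which pass curves `γ` with `γ(t₁) = b`, `γ_{m+1} = F_s` near `t₁`,
`|γ_i'(t₁)| ≤ 1` and `|(g_c ∘ γ)'(t₁)| ≤ 1`.  Then `|ψ'(t₁) ∂g_c/∂x_{m+1}(a₀, ψ(t₁))| ≤ 3 + m B₁`.
[cite: BhardwajVanDenDries2022, Lemma 6.2 (proof)] -/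
theorem key_estimate {U : Set (Fin (m + 1) → ℝ)} (hU : IsOpen U)
    (g : Fin n → (Fin (m + 1) → ℝ) → ℝ) (hg : ∀ c, ContDiffOn ℝ 1 (g c) U)
    {B₁ : ℝ} (hgB : ∀ c, ∀ y ∈ U, ∀ i : Fin m, |pderiv (Fin.castSucc i) (g c) y| ≤ B₁)
    (F : ℝ → ℝ → ℝ) (ψ : ℝ → ℝ) {t₁ : ℝ}
    (hlim0 : Tendsto (fun s => F s t₁) (𝓝[>] 0) (𝓝 (ψ t₁)))
    (hlim1 : Tendsto (fun s => deriv (F s) t₁) (𝓝[>] 0) (𝓝 (deriv ψ t₁)))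
    (hF1 : ∀ s ∈ Ioo (0 : ℝ) 1, |deriv (F s) t₁| ≤ 1)
    {a₀ : Fin m → ℝ} (ha₀ : (Fin.snoc a₀ (ψ t₁) : Fin (m + 1) → ℝ) ∈ U)
    (hmax : ∀ s ∈ Ioo (0 : ℝ) 1,
      (∀ y : Fin (m + 1) → ℝ, (∀ i, |y i - (Fin.snoc a₀ (F s t₁) : Fin (m + 1) → ℝ) i| < s) → y ∈ U) →
      ∃ b ∈ U, (∃ c₀, ∀ c, |pderiv (Fin.last m) (g c) (Fin.snoc a₀ (F s t₁))| ≤ |pderiv (Fin.last m) (g c₀) b|) ∧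
        ∃ γ : ℝ → Fin (m + 1) → ℝ, γ t₁ = b ∧ (∀ᶠ t in 𝓝 t₁, γ t (Fin.last m) = F s t) ∧
          (∀ i, DifferentiableAt ℝ (fun t => γ t i) t₁) ∧ (∀ i, |deriv (fun t => γ t i) t₁| ≤ 1) ∧
          (∀ c, DifferentiableAt ℝ (fun t => g c (γ t)) t₁) ∧ (∀ c, |deriv (fun t => g c (γ t)) t₁| ≤ 1)) :
    ∀ c, |deriv ψ t₁ * pderiv (Fin.last m) (g c) (Fin.snoc a₀ (ψ t₁))| ≤ 3 + m * B₁ := by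
  intro c
  rcases isEmpty_or_nonempty (Fin n) with hn | hn
  · exact hn.elim c
  -- continuity of the last partials on `U`
  have hcont : ∀ c, ContinuousOn (fun y => pderiv (Fin.last m) (g c) y) U := by
    intro c
    have h := ((hg c).continuousOn_fderiv_of_isOpen hU le_rfl)
    exact h.clm_apply continuousOn_const
  -- the section `t ↦ (a₀, t)` is continuous
  have hsnoc : Continuous (fun t : ℝ => (Fin.snoc a₀ t : Fin (m + 1) → ℝ)) := by
    refine continuous_pi fun i => ?_
    refine Fin.lastCases ?_ (fun j => ?_) i
    · simp only [Fin.snoc_last]; exact continuous_id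
    · simp only [Fin.snoc_castSucc]; exact continuous_const
  ----------------------------------------------------------------- (i), (ii), (iii): `s` small
  -- (iii) room around `(a₀, ψ t₁)`
  obtain ⟨ρ, hρ, hρU⟩ : ∃ ρ > 0, ∀ y : Fin (m + 1) → ℝ,
      (∀ i, |y i - (Fin.snoc a₀ (ψ t₁) : Fin (m + 1) → ℝ) i| < 2 * ρ) → y ∈ U := by
    obtain ⟨ε, hε, hball⟩ := Metric.isOpen_iff.mp hU _ ha₀
    refine ⟨ε / 2, half_pos hε, fun y hy => hball ?_⟩
    rw [Metric.mem_ball, dist_pi_lt_iff hε]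
    intro i; rw [Real.dist_eq]; linarith [hy i]
  -- (i) continuity of the last partials at `(a₀, ψ t₁)` along `t ↦ (a₀, F_s t₁)`
  have hconv_pt : Tendsto (fun s => (Fin.snoc a₀ (F s t₁) : Fin (m + 1) → ℝ)) (𝓝[>] 0) (𝓝 (Fin.snoc a₀ (ψ t₁))) :=
    (hsnoc.tendsto _).comp hlim0
  have hi : ∀ c', ∀ᶠ s in 𝓝[>] (0 : ℝ),
      |pderiv (Fin.last m) (g c') (Fin.snoc a₀ (ψ t₁)) - pderiv (Fin.last m) (g c') (Fin.snoc a₀ (F s t₁))| ≤ 1 := by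
    intro c'
    have hca : ContinuousAt (fun y => pderiv (Fin.last m) (g c') y) (Fin.snoc a₀ (ψ t₁)) :=
      (hcont c').continuousAt (hU.mem_nhds ha₀)
    have h := (hca.tendsto.comp hconv_pt)
    rw [Metric.tendsto_nhds] at h
    filter_upwards [h 1 one_pos] with s hs
    rw [Real.dist_eq, abs_sub_comm] at hs
    exact hs.le
  -- (ii)
  have hii : ∀ᶠ s in 𝓝[>] (0 : ℝ),
      |deriv (F s) t₁ - deriv ψ t₁| * |pderiv (Fin.last m) (g c) (Fin.snoc a₀ (ψ t₁))| ≤ 1 := by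
    set A := |pderiv (Fin.last m) (g c) (Fin.snoc a₀ (ψ t₁))| with hA
    have hA0 : 0 ≤ A := abs_nonneg _
    have h := hlim1
    rw [Metric.tendsto_nhds] at h
    filter_upwards [h (1 / (A + 1)) (by positivity)] with s hs
    rw [Real.dist_eq] at hs
    calc |deriv (F s) t₁ - deriv ψ t₁| * A ≤ 1 / (A + 1) * A := mul_le_mul_of_nonneg_right hs.le hA0
      _ ≤ 1 := by rw [div_mul_eq_mul_div, one_mul, div_le_one (by positivity)]; linarith
  -- (iii)
  have hiii : ∀ᶠ s in 𝓝[>] (0 : ℝ), ∀ y : Fin (m + 1) → ℝ,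
      (∀ i, |y i - (Fin.snoc a₀ (F s t₁) : Fin (m + 1) → ℝ) i| < s) → y ∈ U := by
    have h := hlim0
    rw [Metric.tendsto_nhds] at h
    filter_upwards [h ρ hρ, Ioo_mem_nhdsGT hρ] with s hs hsρ
    intro y hy
    apply hρU
    intro i
    refine Fin.lastCases ?_ (fun j => ?_) i
    · have h1 := hy (Fin.last m)
      simp only [Fin.snoc_last] at h1 ⊢
      rw [Real.dist_eq] at hs
      calc |y (Fin.last m) - ψ t₁| ≤ |y (Fin.last m) - F s t₁| + |F s t₁ - ψ t₁| := abs_sub_le _ _ _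
        _ < s + ρ := add_lt_add h1 hs
        _ < 2 * ρ := by linarith [hsρ.2]
    · have h1 := hy (Fin.castSucc j)
      simp only [Fin.snoc_castSucc] at h1 ⊢
      linarith [hsρ.2]
  obtain ⟨s, ⟨hi', hii', hiii'⟩, hsI⟩ :=
    (((Filter.eventually_all.mpr hi).and (hii.and hiii)).and (Ioo_mem_nhdsGT one_pos)).exists
  ----------------------------------------------------------------- the point `b` and (iv), (v)
  obtain ⟨b, hbU, ⟨c₀, hdom⟩, γ, hγb, hγlast, hγdiff, hγbd, hgγdiff, hgγbd⟩ := hmax s hsI hiii'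
  -- chain rule at `t₁` for `g c₀ ∘ γ`
  have hgb : DifferentiableAt ℝ (g c₀) b :=
    ((hg c₀).differentiableOn one_ne_zero b hbU).differentiableAt (hU.mem_nhds hbU)
  have hchain := deriv_comp_curve (by rw [hγb]; exact hgb) hγdiff (g := g c₀)
  rw [hγb, Fin.sum_univ_castSucc] at hchain
  -- `γ_{m+1}' (t₁) = F_s'(t₁)`
  have hγlast' : deriv (fun t => γ t (Fin.last m)) t₁ = deriv (F s) t₁ := Filter.EventuallyEq.deriv_eq hγlast
  rw [hγlast'] at hchain
  -- `|F_s'(t₁) ∂_{m+1} g_{c₀}(b)| ≤ 1 + m B₁`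
  have hv : |deriv (F s) t₁ * pderiv (Fin.last m) (g c₀) b| ≤ 1 + m * B₁ := by
    have hsum : |∑ i : Fin m, deriv (fun t => γ t (Fin.castSucc i)) t₁ * pderiv (Fin.castSucc i) (g c₀) b| ≤ m * B₁ := by
      calc |∑ i : Fin m, deriv (fun t => γ t (Fin.castSucc i)) t₁ * pderiv (Fin.castSucc i) (g c₀) b|
          ≤ ∑ i : Fin m, |deriv (fun t => γ t (Fin.castSucc i)) t₁ * pderiv (Fin.castSucc i) (g c₀) b| :=
            Finset.abs_sum_le_sum_abs _ _
        _ ≤ ∑ _i : Fin m, B₁ := Finset.sum_le_sum fun i _ => by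
            rw [abs_mul]
            calc |deriv (fun t => γ t (Fin.castSucc i)) t₁| * |pderiv (Fin.castSucc i) (g c₀) b|
                ≤ 1 * B₁ := mul_le_mul (hγbd _) (hgB c₀ b hbU i) (abs_nonneg _) zero_le_one
              _ = B₁ := one_mul _
        _ = m * B₁ := by simp
    have h1 := hgγbd c₀
    rw [hchain] at h1
    -- `|x + y| ≤ 1`, `|x| ≤ mB₁` ⇒ `|y| ≤ 1 + mB₁`
    have heq : deriv (F s) t₁ * pderiv (Fin.last m) (g c₀) b =
        (∑ i : Fin m, deriv (fun t => γ t (Fin.castSucc i)) t₁ * pderiv (Fin.castSucc i) (g c₀) b +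
          deriv (F s) t₁ * pderiv (Fin.last m) (g c₀) b) -
        ∑ i : Fin m, deriv (fun t => γ t (Fin.castSucc i)) t₁ * pderiv (Fin.castSucc i) (g c₀) b := by ring
    rw [heq]
    refine (abs_sub _ _).trans ?_
    linarith
  ----------------------------------------------------------------- the final chain
  set P := pderiv (Fin.last m) (g c) (Fin.snoc a₀ (ψ t₁)) with hP
  set Ps := pderiv (Fin.last m) (g c) (Fin.snoc a₀ (F s t₁)) with hPs
  have h1 : |deriv ψ t₁ * P| ≤ |deriv (F s) t₁| * |P| + 1 := by
    have : deriv ψ t₁ * P = deriv (F s) t₁ * P - (deriv (F s) t₁ - deriv ψ t₁) * P := by ring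
    rw [this]
    calc |deriv (F s) t₁ * P - (deriv (F s) t₁ - deriv ψ t₁) * P|
        ≤ |deriv (F s) t₁ * P| + |(deriv (F s) t₁ - deriv ψ t₁) * P| := abs_sub _ _
      _ ≤ |deriv (F s) t₁| * |P| + 1 := by rw [abs_mul, abs_mul]; exact add_le_add le_rfl hii'
  have h2 : |P| ≤ |Ps| + 1 := by
    have := hi' c
    have h := abs_sub_abs_le_abs_sub P Ps
    linarith
  have h3 : |deriv (F s) t₁| * |Ps| ≤ 1 + m * B₁ := by
    calc |deriv (F s) t₁| * |Ps| ≤ |deriv (F s) t₁| * |pderiv (Fin.last m) (g c₀) b| :=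
          mul_le_mul_of_nonneg_left (hdom c) (abs_nonneg _)
      _ = |deriv (F s) t₁ * pderiv (Fin.last m) (g c₀) b| := (abs_mul _ _).symm
      _ ≤ 1 + m * B₁ := hv
  have hF1' := hF1 s hsI
  calc |deriv ψ t₁ * P| ≤ |deriv (F s) t₁| * |P| + 1 := h1
    _ ≤ |deriv (F s) t₁| * (|Ps| + 1) + 1 := by gcongr
    _ = |deriv (F s) t₁| * |Ps| + |deriv (F s) t₁| + 1 := by ring
    _ ≤ (1 + m * B₁) + 1 + 1 := by gcongr
    _ = 3 + m * B₁ := by ring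

end KeyEstimate


end Literature.ModelTheory.ExponentialFields

end
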